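import Summits.SmoothPoincare4.SmoothPoincare4.Theorems.EntropyRungNoncompactShrinkerGapHeatPositiveLSI
import HarnessLib

/-!
# The logarithmic Sobolev inequality of the shrinker measure in entropy form for compactly supported
# test functions, from the weighted heat flow (crux `EntropyRung.NoncompactShrinkerGap`,
# stmt-SmoothPoincare4-10868, line `collapsed-ends-usc`, skeleton v13)

Registered helper `helper_entFormLSI_of_flow` of the stub `stub_compactSupportLSI` (lead c9). On a complete
connected normalised gradient shrinker `(Mⁿ, g, f)`, GIVEN the weighted heat flow `∂ₛρ = Δρ − g⁻¹(df, dρ)` from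
every datum `c + ψ₀` (`c > 0`, `ψ₀` smooth of compact support; hypothesis `hflow`, the conclusion of
`helper_heatFlowExistence`), every smooth compactly supported `v` satisfies the entropy form of the
logarithmic Sobolev inequality of `e^{-f} dV` with the Bakry–Émery constant `2/K = 4`:

  `∫ v² log v² e^{-f} − m log (m/Z) ≤ 4 ∫ |∇v|² e^{-f}`,  `m = ∫ v² e^{-f}`, `Z = ∫ e^{-f}`

— exactly the hypothesis `EF` of `helper_wForm_of_entForm`. Proof: `helper_positiveLSI_of_flow` for the data
`c + v²`, `c = 1/(k+1)`: `|∇(c + v²)|²/(c + v²) = 4v²|∇v|²/(c + v²) ≤ 4|∇v|²`, and `k → ∞` in the left-hand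
side by dominated convergence (`(c + v²) log (c + v²)` is bounded uniformly in `c ≤ 1`, `e^{-f} ∈ L¹`;
`m_c = m + cZ → m` and `t ↦ t log (t/Z)` is continuous).

References: D. Bakry, I. Gentil, M. Ledoux, *Analysis and Geometry of Markov Diffusion Operators* (2014),
Prop. 5.7.1 and Rem. 5.1.2; J. A. Carrillo, L. Ni, Comm. Anal. Geom. 17 (2009), Thm. 3.1.
-/

noncomputable section

set_option linter.dupNamespace false

open scoped Manifold ContDiff ENNReal NNReal Topology
open MeasureTheory Set Filter
open Literature.Geometry.Lorentzian Literature.Geometry.Riemannian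

namespace Summit.SmoothPoincare4.SmoothPoincare4.Theorems.NoncompactShrinkerGapHeat

open Summit.SmoothPoincare4.SmoothPoincare4.Theorems.NoncompactShrinkerGapCarrilloNiClauses

/-- **Helper `helper_entFormLSI_of_flow`** (line `collapsed-ends-usc`, v13; see the module docstring): the
entropy-form logarithmic Sobolev inequality of the shrinker measure for compactly supported smooth test
functions, given the weighted heat flow from positive data `c + ψ₀`.
[cite: BakryGentilLedoux2014, Prop. 5.7.1] [cite: CarrilloNi2009, Thm. 3.1] -/
theorem helper_entFormLSI_of_flow : ∀ (n : ℕ) (M : Type) [TopologicalSpace M] [T2Space M] [SecondCountableTopology M] [ChartedSpace (EuclideanSpace ℝ (Fin n)) M] [IsManifold (𝓡 n) ∞ M] [ConnectedSpace M] [T3Space M] [MeasurableSpace M] [BorelSpace M] (g : PseudoRiemannianMetric (𝓡 n) ∞ (EuclideanSpace ℝ (Fin n)) (TangentSpace (𝓡 n) : M → Type _)) [g.HasLeviCivita] (f : M → ℝ) (hg : g.IsRiemannian), (∀ (x : M) (r : NNReal), IsCompact {y : M | g.edist hg x y ≤ r}) → ContMDiff (𝓡 n) 𝓘(ℝ, ℝ)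 ∞ f → (∀ (x : M) (X Y : TangentSpace (𝓡 n) x), g.ricci x X Y + g.hessian f x X Y = (1 / 2 : ℝ) * g.val x X Y) → (∀ x : M, g.scalarCurvature x + g.gradSq f x = f x) → (∀ (c : ℝ) (ψ₀ : M → ℝ), 0 < c → ContMDiff (𝓡 n) 𝓘(ℝ, ℝ) ∞ ψ₀ → HasCompactSupport ψ₀ → ∀ T : ℝ, 0 < T → ∃ (O : Set ℝ) (ρ : ℝ → M → ℝ), IsOpen O ∧ Icc 0 T ⊆ O ∧ ContMDiffOn ((𝓡 n).prod 𝓘(ℝ, ℝ)) 𝓘(ℝ, ℝ) ∞ (fun p : M × ℝ ↦ ρ p.2 p.1) (univ ×ˢ O) ∧ (∀ x, ρ 0 x = c + ψ₀ x) ∧ (∀ s ∈ Icc 0 T, ∀ x, deriv (fun r ↦ ρ r x) s = g.dalembertian (ρ s) x - g.innerDual x (mvfderiv (𝓡 n) f x).toLinearMap (mvfderiv (𝓡 n) (ρ s) x).toLinearMap) ∧ Integrable (fun p : M × ℝ ↦ (ρ p.2 p.1 - c) ^ 2 * Real.exp (-f p.1)) ((g.riemVolume.prod (volume : Measure ℝ)).restrict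 (univ ×ˢ Ioo 0 T))) → ∀ v : M → ℝ, ContMDiff (𝓡 n) 𝓘(ℝ, ℝ) ∞ v → HasCompactSupport v → ∫ x, v x ^ 2 * Real.log (v x ^ 2) * Real.exp (-f x) ∂g.riemVolume - (∫ x, v x ^ 2 * Real.exp (-f x) ∂g.riemVolume) * Real.log ((∫ x, v x ^ 2 * Real.exp (-f x) ∂g.riemVolume) / (∫ x, Real.exp (-f x) ∂g.riemVolume)) ≤ 4 * ∫ x, g.gradSq v x * Real.exp (-f x) ∂g.riemVolume := by
  intro n M _ _ _ _ _ _ _ _ _ g _ f hg hc hf hsol hnorm hflow v hv hvc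
  classical
  haveI := CarrilloNi2009_shrinkerLSI.isFiniteMeasureOnCompacts_riemVolume hg
  /- the shrinker toolkit: `M` nonempty, `e^{-f} ∈ L¹`, `Z > 0` -/
  obtain ⟨-, hne, -⟩ := scalarCurvature_nonneg_and_isCompact_sublevel g f hg hc hf hsol hnorm
  haveI := hne
  have hZi : Integrable (fun x ↦ Real.exp (-f x)) g.riemVolume :=
    carrilloNi_integrable_exp_neg g f hg hc hf hsol hnorm
  set μ : Measure M := g.riemVolume with hμ
  set Z : ℝ := ∫ x, Real.exp (-f x) ∂μ with hZdef
  have hZ : 0 < Z := by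
    rw [hZdef, integral_pos_iff_support_of_nonneg (fun x ↦ (Real.exp_pos _).le) hZi]
    have : Function.support (fun x ↦ Real.exp (-f x)) = univ := by ext x; simp [Real.exp_ne_zero]
    simpa [this] using PseudoRiemannianMetric.riemVolume_univ_pos hg
  /- the data `ψ₀ = v²`, `c_k = 1/(k+1)` and the positive-datum inequalities -/
  have hψs : ContMDiff (𝓡 n) 𝓘(ℝ, ℝ) ∞ (fun y ↦ v y ^ 2) := hv.pow 2
  have hψc : HasCompactSupport (fun y ↦ v y ^ 2) :=
    HasCompactSupport.intro hvc.isCompact fun x hx ↦ by simp [image_eq_zero_of_notMem_tsupport hx]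
  have hψ0 : ∀ x, 0 ≤ v x ^ 2 := fun x ↦ sq_nonneg _
  set cs : ℕ → ℝ := fun k ↦ 1 / ((k : ℝ) + 1) with hcs
  have hcpos : ∀ k, 0 < cs k := fun k ↦ by rw [hcs]; positivity
  have hcle : ∀ k, cs k ≤ 1 := fun k ↦ by
    rw [hcs]; dsimp only
    rw [div_le_one (by positivity)]
    linarith [(Nat.cast_nonneg k : (0 : ℝ) ≤ k)]
  have hclim : Tendsto cs atTop (𝓝 0) := tendsto_one_div_add_atTop_nhds_zero_nat
  have hk : ∀ k : ℕ,
      ∫ x, (cs k + v x ^ 2) * Real.log (cs k + v x ^ 2) * Real.exp (-f x) ∂μ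
        - (∫ x, (cs k + v x ^ 2) * Real.exp (-f x) ∂μ) *
          Real.log ((∫ x, (cs k + v x ^ 2) * Real.exp (-f x) ∂μ) / Z) ≤
      ∫ x, g.gradSq (fun y ↦ cs k + v y ^ 2) x / (cs k + v x ^ 2) * Real.exp (-f x) ∂μ := fun k ↦
    helper_positiveLSI_of_flow n M g f hg hc hf hsol hnorm (cs k) (fun y ↦ v y ^ 2) (hcpos k) hψs hψc
      hψ0 (hflow (cs k) (fun y ↦ v y ^ 2) (hcpos k) hψs hψc)
  /- Claim 1: `I(c + v²) ≤ 4 ∫ |∇v|² e^{-f}` -/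
  have hWc : Continuous fun x ↦ Real.exp (-f x) := Real.continuous_exp.comp hf.continuous.neg
  have hGc : Continuous (g.gradSq v) := (contMDiff_gradSq g hv).continuous
  have hGcs : HasCompactSupport (g.gradSq v) :=
    HasCompactSupport.intro hvc.isCompact fun x hx ↦
      innerDual_mvfderiv_eq_zero_of_notMem_tsupport_left (g := g) hx
  have hG0 : ∀ x, 0 ≤ g.gradSq v x := fun x ↦ g.gradSq_nonneg hg v x
  have hRint : Integrable (fun x ↦ 4 * (g.gradSq v x * Real.exp (-f x))) μ :=
    ((hGc.mul hWc).integrable_of_hasCompactSupport (hGcs.mul_right)).const_mul 4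
  have hI : ∀ c : ℝ, 0 < c →
      ∫ x, g.gradSq (fun y ↦ c + v y ^ 2) x / (c + v x ^ 2) * Real.exp (-f x) ∂μ ≤
        4 * ∫ x, g.gradSq v x * Real.exp (-f x) ∂μ := by
    intro c hc0
    have hgrad : ∀ x, g.gradSq (fun y ↦ c + v y ^ 2) x = (2 * v x) ^ 2 * g.gradSq v x := fun x ↦ by
      have hd : HasDerivAt (fun t : ℝ ↦ c + t ^ 2) (2 * v x) (v x) := by
        simpa using (hasDerivAt_pow 2 (v x)).const_add c
      have h := PseudoRiemannianMetric.gradSq_real_comp (g := g) (I := 𝓡 n) (φ := v)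
        (h := fun t : ℝ ↦ c + t ^ 2) (x := x) hd (hv.mdifferentiableAt (by simp))
      simpa [Function.comp_def] using h
    rw [← integral_const_mul]
    refine integral_mono_of_nonneg (Eventually.of_forall fun x ↦ ?_) hRint
      (Eventually.of_forall fun x ↦ ?_)
    · have hpos : 0 < c + v x ^ 2 := by positivity
      exact mul_nonneg (div_nonneg (g.gradSq_nonneg hg _ x) hpos.le) (Real.exp_pos _).le
    · have hpos : 0 < c + v x ^ 2 := by positivity
      show g.gradSq (fun y ↦ c + v y ^ 2) x / (c + v x ^ 2) * Real.exp (-f x) ≤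
        4 * (g.gradSq v x * Real.exp (-f x))
      rw [hgrad x]
      have h1 : (2 * v x) ^ 2 * g.gradSq v x / (c + v x ^ 2) ≤ 4 * g.gradSq v x := by
        rw [div_le_iff₀ hpos]
        nlinarith [hG0 x, sq_nonneg (v x)]
      have := mul_le_mul_of_nonneg_right h1 (Real.exp_pos (-f x)).le
      linarith
  /- Claims 2 and 3: the left-hand side converges as `c_k → 0` -/
  obtain ⟨S, hS⟩ := hv.continuous.bounded_above_of_compact_support hvc
  have hv2 : ∀ x, v x ^ 2 ≤ S ^ 2 := fun x ↦ by
    have h1 : |v x| ≤ S := by simpa [Real.norm_eq_abs] using hS x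
    have h2 : |v x| ^ 2 ≤ S ^ 2 := pow_le_pow_left₀ (abs_nonneg _) h1 2
    simpa [sq_abs] using h2
  obtain ⟨B, hB⟩ := isCompact_Icc.exists_bound_of_continuousOn
    (s := Icc (0 : ℝ) (S ^ 2 + 1)) Real.continuous_mul_log.continuousOn
  have hmeas : ∀ k, AEStronglyMeasurable
      (fun x ↦ (cs k + v x ^ 2) * Real.log (cs k + v x ^ 2) * Real.exp (-f x)) μ := fun k ↦ by
    refine (Continuous.mul ?_ hWc).aestronglyMeasurable
    exact Real.continuous_mul_log.comp (continuous_const.add (hv.continuous.pow 2))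
  have LA : Tendsto (fun k ↦ ∫ x, (cs k + v x ^ 2) * Real.log (cs k + v x ^ 2) * Real.exp (-f x) ∂μ)
      atTop (𝓝 (∫ x, v x ^ 2 * Real.log (v x ^ 2) * Real.exp (-f x) ∂μ)) := by
    refine tendsto_integral_of_dominated_convergence (fun x ↦ B * Real.exp (-f x)) hmeas
      (hZi.const_mul B) (fun k ↦ Eventually.of_forall fun x ↦ ?_) (Eventually.of_forall fun x ↦ ?_)
    · have ht : cs k + v x ^ 2 ∈ Icc (0 : ℝ) (S ^ 2 + 1) :=
        ⟨by positivity, by linarith [hv2 x, hcle k]⟩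
      have h1 := hB _ ht
      rw [Real.norm_eq_abs] at h1
      rw [Real.norm_eq_abs, abs_mul, abs_of_nonneg (Real.exp_pos _).le]
      exact mul_le_mul_of_nonneg_right h1 (Real.exp_pos _).le
    · have h1 : Tendsto (fun k ↦ cs k + v x ^ 2) atTop (𝓝 (v x ^ 2)) := by
        simpa using hclim.add_const (v x ^ 2)
      have h2 := ((Real.continuous_mul_log.tendsto _).comp h1).mul_const (Real.exp (-f x))
      simpa [Function.comp_def] using h2
  have hmeas' : ∀ k, AEStronglyMeasurable (fun x ↦ (cs k + v x ^ 2) * Real.exp (-f x)) μ := fun k ↦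
    ((continuous_const.add (hv.continuous.pow 2)).mul hWc).aestronglyMeasurable
  have Lm : Tendsto (fun k ↦ ∫ x, (cs k + v x ^ 2) * Real.exp (-f x) ∂μ) atTop
      (𝓝 (∫ x, v x ^ 2 * Real.exp (-f x) ∂μ)) := by
    refine tendsto_integral_of_dominated_convergence (fun x ↦ (S ^ 2 + 1) * Real.exp (-f x)) hmeas'
      (hZi.const_mul _) (fun k ↦ Eventually.of_forall fun x ↦ ?_) (Eventually.of_forall fun x ↦ ?_)
    · rw [Real.norm_eq_abs, abs_mul, abs_of_nonneg (Real.exp_pos _).le,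
        abs_of_nonneg (by positivity : (0 : ℝ) ≤ cs k + v x ^ 2)]
      exact mul_le_mul_of_nonneg_right (by linarith [hv2 x, hcle k]) (Real.exp_pos _).le
    · have h1 : Tendsto (fun k ↦ cs k + v x ^ 2) atTop (𝓝 (v x ^ 2)) := by
        simpa using hclim.add_const (v x ^ 2)
      exact h1.mul_const _
  have hφ : Continuous fun t : ℝ ↦ t * Real.log (t / Z) := by
    have : (fun t : ℝ ↦ t * Real.log (t / Z)) = fun t ↦ t * Real.log t - t * Real.log Z := by
      funext t
      by_cases ht : t = 0
      · simp [ht]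
      · rw [Real.log_div ht hZ.ne']; ring
    rw [this]
    exact Real.continuous_mul_log.sub (continuous_id.mul continuous_const)
  have Llhs := LA.sub ((hφ.tendsto _).comp Lm)
  /- conclusion -/
  refine le_of_tendsto' Llhs fun k ↦ ?_
  have h := (hk k).trans (hI (cs k) (hcpos k))
  simpa [Function.comp_def] using h

end Summit.SmoothPoincare4.SmoothPoincare4.Theorems.NoncompactShrinkerGapHeat

end
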